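import Mathlib
import Summits.KontsevichZagierPeriods.KontsevichZagierPeriods.Theorems.SoloInformedDivisionCirc
import Summits.KontsevichZagierPeriods.KontsevichZagierPeriods.Theorems.SoloInformedKummerFixedPoint
import HarnessLib
import HarnessLib.Audit

/-!
# Division by translation X: THEOREM XXIX(iii) KERNEL — negative torsion at every order (solo-informed, s43)

The pole involution `n ↦ N = (m − n)/(1 − n)` of THEOREM XXVIII(c) KERNEL
(`soloInformed_kummer_poleInvolution_law`: `⟦1−m⟧·⟦Π_N⟧ = ⟦1−n⟧·(⟦m/n⟧·⟦K⟧ + ⟦1−m/n⟧·⟦Π_n⟧)`, point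
classes as scalars) TRANSPORTS every decomposition `⟦Π_n⟧ = ⟦[pt,a]⟧⟦K⟧ + ⟦[pt,b]⟧⟦π⟧` with algebraic
`a, b` to the image parameter:

  **`⟦Π_N⟧ = ⟦[pt,a']⟧⟦K⟧ + ⟦[pt,b']⟧⟦π⟧`,  `a' = (1−n)(m/n + (1−m/n)a)/(1−m)`,  `b' = (1−n)(1−m/n)b/(1−m)`**
  (`soloInformed_kummer_poleInvolution_transport`).

Applied to the circular torsion parameters `n = 1 − m' s_p²` of part IX (`m = 1 − m'`, `(s_j)` a division
chain of order `q` for `m'`) it gives the NEGATIVE torsion parameters `N = −(1 − s_p²)/s_p²` (model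
`N = −cs²/sn²(pK'/q | m')`):

  **`⟦Π(−(1−s_p²)/s_p² | 1−m')⟧ = ⟦[pt,a']⟧⟦K⟧ + ⟦[pt,b']⟧⟦π⟧`,
   `a' = s_p²·((1−m')/(1−m's_p²) + (m'(1−s_p²)/(1−m's_p²))·A)`,  `b' = s_p²·(m'(1−s_p²)/(1−m's_p²))·B`**

with the `A, B` of part IX (`soloInformed_divChain_negative`, values `…_value`) — THEOREM XXIX(iii) at EVERY
torsion order, by one-dimensional moves, given the chain.  E.g. (trisection chain, `s = ⅔`, `m' = 27/32`):
`27·Π(−5/4 | 5/32) = 7·K + 4√2·π`.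

References: Abramowitz–Stegun 17.7.17; C. Heuman, J. Math. Phys. 20 (1941);
M. Kontsevich, D. Zagier, *Periods* (2001), §1.2; this work.
-/

noncomputable section

open MeasureTheory Set Filter
open scoped Classical

open Literature.NumberTheory.Transcendental Literature.NumberTheory.Transcendental.KZ
open Literature.ModelTheory.ExponentialFields

namespace Summit.KontsevichZagierPeriods.KontsevichZagierPeriods.Theorems

/-- **LEMMA (transport under the pole involution).** If `⟦Π_n⟧ = ⟦[pt,a]⟧⟦K⟧ + ⟦[pt,b]⟧⟦π⟧` in `P`
with `a, b` algebraic (`n < 1`, `n ≠ 0`), then `⟦Π_N⟧ = ⟦[pt,a']⟧⟦K⟧ + ⟦[pt,b']⟧⟦π⟧` for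
`N = (m−n)/(1−n)`, `a' = (1−m)⁻¹(1−n)(m/n + (1−m/n)a)`, `b' = (1−m)⁻¹(1−n)(1−m/n)b`. [this work] -/
theorem soloInformed_kummer_poleInvolution_transport (m n a b : ℝ) (hm : m ∈ Ioo (0:ℝ) 1)
    (hma : IsAlgebraic ℚ m) (hn : n < 1) (hn0 : n ≠ 0) (hna : IsAlgebraic ℚ n)
    (ha : IsAlgebraic ℚ a) (hb : IsAlgebraic ℚ b) (PN K P : IntegralRep 1)
    (hPNd : PN.domain = {x | x 0 ∈ Ioo (0:ℝ) 1})
    (hPNi : EqOn PN.integrand (fun x => (1 - (m - n) / (1 - n) * x 0 ^ 2)⁻¹ *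
      ((√(1 - x 0 ^ 2))⁻¹ * (√(1 - m * x 0 ^ 2))⁻¹)) PN.domain)
    (hKd : K.domain = {x | x 0 ∈ Ioo (0:ℝ) 1})
    (hKi : EqOn K.integrand (fun x => (√(1 - x 0 ^ 2))⁻¹ * (√(1 - m * x 0 ^ 2))⁻¹) K.domain)
    (hPd : P.domain = {x | x 0 ∈ Ioo (0:ℝ) 1})
    (hPi : EqOn P.integrand (fun x => (1 - n * x 0 ^ 2)⁻¹ *
      ((√(1 - x 0 ^ 2))⁻¹ * (√(1 - m * x 0 ^ 2))⁻¹)) P.domain)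
    (hP : toFormalPeriod (of P) =
      toFormalPeriod (of (IntegralRep.unit.constMul a ha)) * toFormalPeriod (of K) +
        toFormalPeriod (of (IntegralRep.unit.constMul b hb)) * toFormalPeriod (of KZ.piRep)) :
    ∀ ha' : IsAlgebraic ℚ ((1 - m)⁻¹ * ((1 - n) * (m / n + (1 - m / n) * a))),
    ∀ hb' : IsAlgebraic ℚ ((1 - m)⁻¹ * ((1 - n) * ((1 - m / n) * b))),
      toFormalPeriod (of PN) =
        toFormalPeriod (of (IntegralRep.unit.constMul _ ha')) * toFormalPeriod (of K) +
          toFormalPeriod (of (IntegralRep.unit.constMul _ hb')) * toFormalPeriod (of KZ.piRep) := by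
  intro ha' hb'
  have hc1 : IsAlgebraic ℚ (m / n) := by rw [div_eq_mul_inv]; exact hma.mul hna.inv
  have hc2 : IsAlgebraic ℚ (1 - m / n) := isAlgebraic_one.sub hc1
  have h1m0 : 1 - m ≠ 0 := (sub_pos.mpr hm.2).ne'
  have h1mi : IsAlgebraic ℚ (1 - m)⁻¹ := (isAlgebraic_one.sub hma).inv
  have L := soloInformed_kummer_poleInvolution_law m n hm hma hn hn0 hna hc1 hc2 PN K P hPNd hPNi
    hKd hKi hPd hPi
  rw [hP] at L
  have ha2 := hc2.mul ha
  have ha3 := hc1.add ha2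
  have ha4 := (isAlgebraic_one.sub hna).mul ha3
  have hb2 := hc2.mul hb
  have hb3 := (isAlgebraic_one.sub hna).mul hb2
  have Q1 : toFormalPeriod (of (IntegralRep.unit.constMul _ h1mi)) *
      toFormalPeriod (of (IntegralRep.unit.constMul _ (isAlgebraic_one.sub hma))) = 1 :=
    soloInformed_pointRep_inv_mul _ _ h1m0 h1mi
  have Q2 : toFormalPeriod (of (IntegralRep.unit.constMul _ hc2)) *
      toFormalPeriod (of (IntegralRep.unit.constMul _ ha)) =
      toFormalPeriod (of (IntegralRep.unit.constMul _ ha2)) := soloInformed_pointRep_mul _ _ hc2 ha ha2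
  have Q3 : toFormalPeriod (of (IntegralRep.unit.constMul _ hc1)) +
      toFormalPeriod (of (IntegralRep.unit.constMul _ ha2)) =
      toFormalPeriod (of (IntegralRep.unit.constMul _ ha3)) := soloInformed_pointRep_add _ _ hc1 ha2 ha3
  have Q4 : toFormalPeriod (of (IntegralRep.unit.constMul _ (isAlgebraic_one.sub hna))) *
      toFormalPeriod (of (IntegralRep.unit.constMul _ ha3)) =
      toFormalPeriod (of (IntegralRep.unit.constMul _ ha4)) :=
    soloInformed_pointRep_mul _ _ (isAlgebraic_one.sub hna) ha3 ha4
  have Q5 : toFormalPeriod (of (IntegralRep.unit.constMul _ h1mi)) *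
      toFormalPeriod (of (IntegralRep.unit.constMul _ ha4)) =
      toFormalPeriod (of (IntegralRep.unit.constMul _ ha')) := soloInformed_pointRep_mul _ _ h1mi ha4 ha'
  have Q6 : toFormalPeriod (of (IntegralRep.unit.constMul _ hc2)) *
      toFormalPeriod (of (IntegralRep.unit.constMul _ hb)) =
      toFormalPeriod (of (IntegralRep.unit.constMul _ hb2)) := soloInformed_pointRep_mul _ _ hc2 hb hb2
  have Q7 : toFormalPeriod (of (IntegralRep.unit.constMul _ (isAlgebraic_one.sub hna))) *
      toFormalPeriod (of (IntegralRep.unit.constMul _ hb2)) =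
      toFormalPeriod (of (IntegralRep.unit.constMul _ hb3)) :=
    soloInformed_pointRep_mul _ _ (isAlgebraic_one.sub hna) hb2 hb3
  have Q8 : toFormalPeriod (of (IntegralRep.unit.constMul _ h1mi)) *
      toFormalPeriod (of (IntegralRep.unit.constMul _ hb3)) =
      toFormalPeriod (of (IntegralRep.unit.constMul _ hb')) := soloInformed_pointRep_mul _ _ h1mi hb3 hb'
  linear_combination toFormalPeriod (of (IntegralRep.unit.constMul _ h1mi)) * L -
    toFormalPeriod (of PN) * Q1 +
    toFormalPeriod (of K) * toFormalPeriod (of (IntegralRep.unit.constMul _ h1mi)) *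
      toFormalPeriod (of (IntegralRep.unit.constMul _ (isAlgebraic_one.sub hna))) * Q2 +
    toFormalPeriod (of K) * toFormalPeriod (of (IntegralRep.unit.constMul _ h1mi)) *
      toFormalPeriod (of (IntegralRep.unit.constMul _ (isAlgebraic_one.sub hna))) * Q3 +
    toFormalPeriod (of K) * toFormalPeriod (of (IntegralRep.unit.constMul _ h1mi)) * Q4 +
    toFormalPeriod (of K) * Q5 +
    toFormalPeriod (of KZ.piRep) * toFormalPeriod (of (IntegralRep.unit.constMul _ h1mi)) *
      toFormalPeriod (of (IntegralRep.unit.constMul _ (isAlgebraic_one.sub hna))) * Q6 +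
    toFormalPeriod (of KZ.piRep) * toFormalPeriod (of (IntegralRep.unit.constMul _ h1mi)) * Q7 +
    toFormalPeriod (of KZ.piRep) * Q8

/-- **THEOREM XXIX(iii) KERNEL (negative torsion parameters, every order).** For a division chain `(s_j)`
of order `q` for `m'` and `0 < p < q`:  `⟦Π(−(1−s_p²)/s_p² | 1−m')⟧ = ⟦[pt,a']⟧·⟦K⟧ + ⟦[pt,b']⟧·⟦π⟧` in
`P` with the ALGEBRAIC `a' = s_p²((1−m')/(1−m's_p²) + (m'(1−s_p²)/(1−m's_p²))·A)`,
`b' = s_p²(m'(1−s_p²)/(1−m's_p²))·B`, `A = 1 − (pζ_q − qζ_p)/(qc)`, `B = ((q−p)/2)/(qc)`,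
`c = m's_p√(1−s_p²)/√(1−m's_p²)`. [this work] -/
theorem soloInformed_divChain_negative {m' : ℝ} {q : ℕ} (c : SoloInformedDivChain m' q)
    (hm' : m' ∈ Ioo (0:ℝ) 1) (hm'a : IsAlgebraic ℚ m') {p : ℕ} (hp0 : 0 < p) (hpq : p < q)
    (PN K : IntegralRep 1) (hPNd : PN.domain = {x | x 0 ∈ Ioo (0:ℝ) 1})
    (hPNi : EqOn PN.integrand (fun x => (1 + (1 - c.s p ^ 2) / c.s p ^ 2 * x 0 ^ 2)⁻¹ *
      ((√(1 - x 0 ^ 2))⁻¹ * (√(1 - (1 - m') * x 0 ^ 2))⁻¹)) PN.domain)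
    (hKd : K.domain = {x | x 0 ∈ Ioo (0:ℝ) 1})
    (hKi : EqOn K.integrand (fun x => (√(1 - x 0 ^ 2))⁻¹ * (√(1 - (1 - m') * x 0 ^ 2))⁻¹)
      K.domain) :
    ∃ a b : ℝ, IsAlgebraic ℚ a ∧ IsAlgebraic ℚ b ∧
      (∀ (ha : IsAlgebraic ℚ a) (hb : IsAlgebraic ℚ b), toFormalPeriod (of PN) =
        toFormalPeriod (of (IntegralRep.unit.constMul a ha)) * toFormalPeriod (of K) +
          toFormalPeriod (of (IntegralRep.unit.constMul b hb)) * toFormalPeriod (of KZ.piRep)) ∧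
      a = c.s p ^ 2 * ((1 - m') / (1 - m' * c.s p ^ 2) +
        m' * (1 - c.s p ^ 2) / (1 - m' * c.s p ^ 2) *
          (1 - ((q : ℝ) * (m' * c.s p * √(1 - c.s p ^ 2) / √(1 - m' * c.s p ^ 2)))⁻¹ *
            ((p : ℝ) * c.zeta q - (q : ℝ) * c.zeta p))) ∧
      b = c.s p ^ 2 * (m' * (1 - c.s p ^ 2) / (1 - m' * c.s p ^ 2) *
        (((q : ℝ) * (m' * c.s p * √(1 - c.s p ^ 2) / √(1 - m' * c.s p ^ 2)))⁻¹ *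
          (((q : ℝ) - (p : ℝ)) / 2))) := by
  have hσ := soloInformed_divChain_mem_Ioo c hm' hm'a hp0 hpq
  have hσa := (soloInformed_divChain_mem c hm' hm'a p hpq.le).2
  have hm : 1 - m' ∈ Ioo (0:ℝ) 1 := soloInformed_kummerHeuman_compl hm'
  have hma : IsAlgebraic ℚ (1 - m') := isAlgebraic_one.sub hm'a
  have hs0 : c.s p ≠ 0 := hσ.1.ne'
  have hm'0 : m' ≠ 0 := hm'.1.ne'
  have hs2 : c.s p ^ 2 < 1 := by nlinarith [hσ.1, hσ.2]
  have hms : m' * c.s p ^ 2 < 1 := by nlinarith [hm'.1, hm'.2, sq_nonneg (c.s p)]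
  have hn : 1 - m' * c.s p ^ 2 ∈ Ioo (0:ℝ) 1 :=
    ⟨by linarith, by nlinarith [hm'.1, pow_pos hσ.1 2]⟩
  have hn0 : 1 - m' * c.s p ^ 2 ≠ 0 := hn.1.ne'
  have hna : IsAlgebraic ℚ (1 - m' * c.s p ^ 2) := isAlgebraic_one.sub (hm'a.mul (hσa.pow 2))
  obtain ⟨P, hPd, hPi⟩ := soloInformed_exists_ellipticPi_rep _ _ hn hna hm hma
  obtain ⟨hA, hB, hcl⟩ := soloInformed_divChain_circular_pointClass c hm' hm'a hp0 hpq P K hPd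
    (fun x _ => hPi x) hKd hKi
  set A := 1 - ((q : ℝ) * (m' * c.s p * √(1 - c.s p ^ 2) / √(1 - m' * c.s p ^ 2)))⁻¹ *
    ((p : ℝ) * c.zeta q - (q : ℝ) * c.zeta p)
  set B := ((q : ℝ) * (m' * c.s p * √(1 - c.s p ^ 2) / √(1 - m' * c.s p ^ 2)))⁻¹ *
    (((q : ℝ) - (p : ℝ)) / 2)
  have hN : ((1 - m') - (1 - m' * c.s p ^ 2)) / (1 - (1 - m' * c.s p ^ 2)) =
      -((1 - c.s p ^ 2) / c.s p ^ 2) := by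
    rw [sub_sub_cancel, sub_sub_sub_cancel_left]; field_simp; ring
  have hPNi' : EqOn PN.integrand (fun x => (1 - ((1 - m') - (1 - m' * c.s p ^ 2)) /
      (1 - (1 - m' * c.s p ^ 2)) * x 0 ^ 2)⁻¹ *
      ((√(1 - x 0 ^ 2))⁻¹ * (√(1 - (1 - m') * x 0 ^ 2))⁻¹)) PN.domain := by
    simp only [hN, neg_mul, sub_neg_eq_add]; exact hPNi
  have T := soloInformed_kummer_poleInvolution_transport (1 - m') (1 - m' * c.s p ^ 2) A B hm hma
    hn.2 hn0 hna hA hB PN K P hPNd hPNi' hKd hKi hPd (fun x _ => hPi x) (hcl hA hB)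
  have hc1 : IsAlgebraic ℚ ((1 - m') / (1 - m' * c.s p ^ 2)) := by
    rw [div_eq_mul_inv]; exact hma.mul hna.inv
  have hc2 : IsAlgebraic ℚ (1 - (1 - m') / (1 - m' * c.s p ^ 2)) := isAlgebraic_one.sub hc1
  have h1n : IsAlgebraic ℚ (1 - (1 - m' * c.s p ^ 2)) := isAlgebraic_one.sub hna
  have h1mi : IsAlgebraic ℚ (1 - (1 - m'))⁻¹ := (isAlgebraic_one.sub hma).inv
  have ha' : IsAlgebraic ℚ ((1 - (1 - m'))⁻¹ * ((1 - (1 - m' * c.s p ^ 2)) *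
      ((1 - m') / (1 - m' * c.s p ^ 2) + (1 - (1 - m') / (1 - m' * c.s p ^ 2)) * A))) :=
    h1mi.mul (h1n.mul (hc1.add (hc2.mul hA)))
  have hb' : IsAlgebraic ℚ ((1 - (1 - m'))⁻¹ * ((1 - (1 - m' * c.s p ^ 2)) *
      ((1 - (1 - m') / (1 - m' * c.s p ^ 2)) * B))) := h1mi.mul (h1n.mul (hc2.mul hB))
  have ea : (1 - (1 - m'))⁻¹ * ((1 - (1 - m' * c.s p ^ 2)) *
      ((1 - m') / (1 - m' * c.s p ^ 2) + (1 - (1 - m') / (1 - m' * c.s p ^ 2)) * A)) =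
      c.s p ^ 2 * ((1 - m') / (1 - m' * c.s p ^ 2) +
        m' * (1 - c.s p ^ 2) / (1 - m' * c.s p ^ 2) * A) := by
    rw [sub_sub_cancel, sub_sub_cancel]; field_simp; ring
  have eb : (1 - (1 - m'))⁻¹ * ((1 - (1 - m' * c.s p ^ 2)) *
      ((1 - (1 - m') / (1 - m' * c.s p ^ 2)) * B)) =
      c.s p ^ 2 * (m' * (1 - c.s p ^ 2) / (1 - m' * c.s p ^ 2) * B) := by
    rw [sub_sub_cancel, sub_sub_cancel]; field_simp; ring
  refine ⟨_, _, ea ▸ ha', eb ▸ hb', fun ha hb => ?_, rfl, rfl⟩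
  rw [T ha' hb', soloInformed_pointRep_congr ha' ha ea, soloInformed_pointRep_congr hb' hb eb]

/-- **THEOREM XXIX(iii), numerically:** `Π(−(1−s_p²)/s_p² | 1−m') = a'·K(1−m') + b'·π` with the algebraic
`a', b'` of `soloInformed_divChain_negative`. [this work] -/
theorem soloInformed_divChain_negative_value {m' : ℝ} {q : ℕ} (c : SoloInformedDivChain m' q)
    (hm' : m' ∈ Ioo (0:ℝ) 1) (hm'a : IsAlgebraic ℚ m') {p : ℕ} (hp0 : 0 < p) (hpq : p < q)
    (PN K : IntegralRep 1) (hPNd : PN.domain = {x | x 0 ∈ Ioo (0:ℝ) 1})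
    (hPNi : EqOn PN.integrand (fun x => (1 + (1 - c.s p ^ 2) / c.s p ^ 2 * x 0 ^ 2)⁻¹ *
      ((√(1 - x 0 ^ 2))⁻¹ * (√(1 - (1 - m') * x 0 ^ 2))⁻¹)) PN.domain)
    (hKd : K.domain = {x | x 0 ∈ Ioo (0:ℝ) 1})
    (hKi : EqOn K.integrand (fun x => (√(1 - x 0 ^ 2))⁻¹ * (√(1 - (1 - m') * x 0 ^ 2))⁻¹)
      K.domain) :
    PN.value = c.s p ^ 2 * ((1 - m') / (1 - m' * c.s p ^ 2) +
        m' * (1 - c.s p ^ 2) / (1 - m' * c.s p ^ 2) *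
          (1 - ((q : ℝ) * (m' * c.s p * √(1 - c.s p ^ 2) / √(1 - m' * c.s p ^ 2)))⁻¹ *
            ((p : ℝ) * c.zeta q - (q : ℝ) * c.zeta p))) * K.value +
      c.s p ^ 2 * (m' * (1 - c.s p ^ 2) / (1 - m' * c.s p ^ 2) *
        (((q : ℝ) * (m' * c.s p * √(1 - c.s p ^ 2) / √(1 - m' * c.s p ^ 2)))⁻¹ *
          (((q : ℝ) - (p : ℝ)) / 2))) * Real.pi := by
  obtain ⟨a, b, ha, hb, h, rfl, rfl⟩ := soloInformed_divChain_negative c hm' hm'a hp0 hpq PN K hPNd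
    hPNi hKd hKi
  have e := congrArg evalP (h ha hb)
  simpa only [map_mul, map_add, evalP_toFormalPeriod_of, IntegralRep.value_constMul,
    IntegralRep.value_unit, mul_one, KZ.piRep_value] using e

end Summit.KontsevichZagierPeriods.KontsevichZagierPeriods.Theorems

end
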